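import Mathlib

/-!
# SoloBlind E65 — the two-prime cell law in Mazur form (binary law at t = 2)

Bookkeeping behind THEOREM V / (E-bin) of the solo-blind Langlands side line (paper/theoremV.md §15 AMENDMENT):
with `a_p = v_ℓ(p-1)`, `a_q = v_ℓ(q-1)`, `e_p = v_ℓ(ord_p q) ≤ a_p`, `e_q = v_ℓ(ord_q p) ≤ a_q`, THEOREM V gives the
Eisenstein depth of the new `(+,+)` cell at level `pq` as `μ = min (a_q + (a_p - e_p)) (a_p + (a_q - e_q))`.
We record, as pure arithmetic:
* `cellDepth_eq_sub_max` : `μ = a_p + a_q - max e_p e_q` (the second form of THEOREM V);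
* `cellDepth_eq_zero_iff` : `μ = 0 ↔ (a_q = 0 ∧ e_p = a_p) ∨ (a_p = 0 ∧ e_q = a_q)`;
* `cellDepth_eq_zero_iff_of_pos` : when `1 ≤ a_p` (the Eisenstein base), `μ = 0 ↔ a_q = 0 ∧ e_p = a_p`, i.e.
  `q ≢ 1 (mod ℓ)` and `q` generates the ℓ-part of `(ℤ/p)ˣ` — Mazur's criterion for `T_q - q - 1` to generate the
  Eisenstein ideal at prime level `p`; this is the binary law (E-bin) at `t = 2`.
-/

namespace Summit.Langlands.Langlands.Theorems

/-- The cell depth of THEOREM V as a function of the four local invariants. -/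
def cellDepth (ap aq ep eq : ℕ) : ℕ := min (aq + (ap - ep)) (ap + (aq - eq))

/-- Second form of THEOREM V: `μ = a_p + a_q - max(e_p, e_q)`. -/
theorem cellDepth_eq_sub_max (ap aq ep eq : ℕ) (hp : ep ≤ ap) (hq : eq ≤ aq) :
    cellDepth ap aq ep eq = ap + aq - max ep eq := by
  unfold cellDepth; omega

/-- The cell depth is at most `m = a_p + a_q`, with equality iff `e_p = e_q = 0`. -/
theorem cellDepth_le (ap aq ep eq : ℕ) : cellDepth ap aq ep eq ≤ ap + aq := by
  unfold cellDepth; omega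

/-- Equality case of `cellDepth_le`. -/
theorem cellDepth_eq_sum_iff (ap aq ep eq : ℕ) (hp : ep ≤ ap) (hq : eq ≤ aq) :
    cellDepth ap aq ep eq = ap + aq ↔ ep = 0 ∧ eq = 0 := by
  unfold cellDepth; omega

/-- Binary law at `t = 2`, symmetric form: the depth vanishes iff one of the two primes is an
`ℓ`-trivial base (`a = 0`, `e` maximal on the other side). -/
theorem cellDepth_eq_zero_iff (ap aq ep eq : ℕ) (hp : ep ≤ ap) (hq : eq ≤ aq) :
    cellDepth ap aq ep eq = 0 ↔ (aq = 0 ∧ ep = ap) ∨ (ap = 0 ∧ eq = aq) := by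
  unfold cellDepth; omega

/-- Binary law at `t = 2`, Mazur form: with `p` the Eisenstein base (`1 ≤ a_p`), the depth vanishes iff
`a_q = 0` and `e_p = a_p` (i.e. `T_q - q - 1` generates the Eisenstein ideal of level `p`). -/
theorem cellDepth_eq_zero_iff_of_pos (ap aq ep eq : ℕ) (h1 : 1 ≤ ap) (hp : ep ≤ ap) (hq : eq ≤ aq) :
    cellDepth ap aq ep eq = 0 ↔ aq = 0 ∧ ep = ap := by
  unfold cellDepth; omega

/-- Positive-depth form of the binary law: `1 ≤ μ` iff `ℓ ∣ q - 1` or `q` fails to generate the `ℓ`-part of `(ℤ/p)ˣ`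
(`e_p < a_p`), for the Eisenstein base `p`. -/
theorem one_le_cellDepth_iff (ap aq ep eq : ℕ) (h1 : 1 ≤ ap) (hp : ep ≤ ap) (hq : eq ≤ aq) :
    1 ≤ cellDepth ap aq ep eq ↔ 1 ≤ aq ∨ ep < ap := by
  unfold cellDepth; omega

end Summit.Langlands.Langlands.Theorems
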